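import Summits.CriticalPhenomena.PercolationContinuityZ3.Theorems.PercNearOneGluingNoHeavyLowerTailMajorityGluingQCertSym
import HarnessLib

/-!
# Soundness of the symmetrised degree-2 certificates over a finite family of points (lane prim-rate, constants-miner 1, gen 36; CANDIDATES §GEN-36, NEXT-g37)

Support file for the closed crux `NoHeavyLowerTail` (stmt-CriticalPhenomena-4575), majority-gluing line; companion of `…MajorityGluingQCertSym`.
ABSTRACT SOUNDNESS.  Let `(v_g)_{g ∈ G}` be a finite nonempty family of nonnegative points with a common `δ`-coordinate `v_g(D) = δ` and a common value
`T(v_g) = μ_T` of the threshold form, each satisfying the marginal hypotheses `m_x(v_g) ≤ v_g(D)` and the listed van den Berg–Kahn rows, and let `val`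
be a nonnegative valuation of keys with the ORBIT PROPERTY **`val (keyS m i j) = Msym v i j := Σ_g v_g(i)·v_g(j)`** for all variables `i, j < NV`
(supplied for the relabelled cut laws of percolation by `…MajorityGluingQCertSymPerm`).  Then a passing certificate (`checkWS`, `checkQS fuel`) gives
**`cD·μ_T ≤ cN·δ`** (`SymCert.soundS`; evaluation form `soundS_of_nonneg` for certificates checked in parts).  The proof evaluates every entry's contribution list against `val` (`evalC_prodCS`, `evalC_rowCS`, `evalC_sqCS`,
`evalC_ellC`, `evalC_linC1`): rows, squares and marginal slacks evaluate to `Σ_g` of nonpositive quantities, the multiplier part to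
`(cN·δ − cD·μ_T)·Σ_{(b,n)} n·Σ_g v_g(b)`, and the latter sum is `≥ ℓ_D·|G|·δ` (`ellDS_mul_le`).  No percolation, no sorries.
-/

namespace Summit.CriticalPhenomena.PercolationContinuityZ3.Theorems

namespace HubOnly
namespace QCert

noncomputable section

open scoped BigOperators

variable {G : Type*} [Fintype G]

/-! ### Sums against the symmetrised moments -/

/-- **Column sums:** `Σ_{i∈S} w_i·Msym(i,b) = Σ_g (Σ_{i∈S} w_i·v_g(i))·v_g(b)`. -/
theorem col_Msym (v : G → ℕ → ℝ) (b : ℕ) (w : ℕ → ℝ) :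
    ∀ S : List ℕ, (S.map fun i => w i * Msym v i b).sum = ∑ g, (S.map fun i => w i * v g i).sum * v g b
  | [] => by simp
  | a :: S => by
    simp only [List.map_cons, List.sum_cons]
    rw [col_Msym v b w S, Msym, Finset.mul_sum, ← Finset.sum_add_distrib]
    refine Finset.sum_congr rfl fun g _ => ?_
    ring

/-- **Row sums:** `Σ_{j∈S} w_j·Msym(a,j) = Σ_g v_g(a)·(Σ_{j∈S} w_j·v_g(j))`. -/
theorem row_Msym (v : G → ℕ → ℝ) (a : ℕ) (w : ℕ → ℝ) :
    ∀ S : List ℕ, (S.map fun j => w j * Msym v a j).sum = ∑ g, v g a * (S.map fun j => w j * v g j).sum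
  | [] => by simp
  | b :: S => by
    simp only [List.map_cons, List.sum_cons]
    rw [row_Msym v a w S, Msym, Finset.mul_sum, ← Finset.sum_add_distrib]
    refine Finset.sum_congr rfl fun g _ => ?_
    ring

/-- **Grid sums:** `Σ_{i∈S₁} Σ_{j∈S₂} w₁(i)·w₂(j)·Msym(i,j) = Σ_g (Σ_{i∈S₁} w₁ v_g)·(Σ_{j∈S₂} w₂ v_g)`. -/
theorem grid_Msym (v : G → ℕ → ℝ) (w₁ w₂ : ℕ → ℝ) (S₂ : List ℕ) :
    ∀ S₁ : List ℕ, (S₁.map fun i => (S₂.map fun j => w₁ i * w₂ j * Msym v i j).sum).sum =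
        ∑ g, (S₁.map fun i => w₁ i * v g i).sum * (S₂.map fun j => w₂ j * v g j).sum
  | [] => by simp
  | a :: S₁ => by
    simp only [List.map_cons, List.sum_cons]
    have hin : (S₂.map fun j => w₁ a * w₂ j * Msym v a j).sum = w₁ a * ∑ g, v g a * (S₂.map fun j => w₂ j * v g j).sum := by
      rw [← row_Msym v a w₂ S₂, ← List.sum_map_mul_left]
      congr 1; refine List.map_congr_left fun j _ => ?_; ring
    rw [hin, grid_Msym v w₁ w₂ S₂ S₁, Finset.mul_sum, ← Finset.sum_add_distrib]
    refine Finset.sum_congr rfl fun g _ => ?_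
    ring

/-- A map with unit weight. -/
theorem map_one_mul (S : List ℕ) (f : ℕ → ℝ) : (S.map fun i => (1 : ℝ) * f i) = S.map f :=
  List.map_congr_left fun _ _ => one_mul _

namespace SymCert

variable (c : SymCert)

section Eval

variable (v : G → ℕ → ℝ) (val : ℕ → ℝ) (hkey : ∀ i < c.NV, ∀ j < c.NV, val (c.key i j) = Msym v i j)
include hkey

/-- **Product contributions:** `evalC (prodCS m1 m2 z) = z·Σ_g f₁(v_g)·f₂(v_g)`. -/
theorem evalC_prodCS (m1 m2 : ℕ) (z : ℤ) :
    evalC val (c.prodCS m1 m2 z) =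
      (z : ℝ) * ∑ g, linv c.NV (fun i => Cert.bi (tb m1 i)) (v g) * linv c.NV (fun i => Cert.bi (tb m2 i)) (v g) := by
  unfold prodCS
  rw [evalC_flatten, List.map_map]
  have hc : (suppOf c.NV (tb m1)).map (evalC val ∘ fun i => (suppOf c.NV (tb m2)).map fun j => (c.key i j, z)) =
      (suppOf c.NV (tb m1)).map fun i => ((suppOf c.NV (tb m2)).map fun j => (1 : ℝ) * (z : ℝ) * Msym v i j).sum :=
    List.map_congr_left fun i hi => by
      rw [Function.comp_apply, evalC_map]
      congr 1
      refine List.map_congr_left fun j hj => ?_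
      simp only []
      rw [hkey i (mem_suppOf hi).1 j (mem_suppOf hj).1]; ring
  rw [hc, grid_Msym v (fun _ => 1) (fun _ => (z : ℝ)), Finset.mul_sum]
  refine Finset.sum_congr rfl fun g _ => ?_
  rw [map_one_mul, List.sum_map_mul_left, linv_bi_eq_suppOf, linv_bi_eq_suppOf]
  ring

/-- **Row contributions:** `evalC (rowCS r) = −n·Σ_g (f₃f₄ − f₁f₂)(v_g)`. -/
theorem evalC_rowCS (r : RowE) :
    evalC val (c.rowCS r) =
      -((r.n : ℝ) * ∑ g, (linv c.NV (fun i => Cert.bi (tb r.m3 i)) (v g) * linv c.NV (fun i => Cert.bi (tb r.m4 i)) (v g) -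
        linv c.NV (fun i => Cert.bi (tb r.m1 i)) (v g) * linv c.NV (fun i => Cert.bi (tb r.m2 i)) (v g))) := by
  unfold rowCS
  rw [evalC_append, c.evalC_prodCS v val hkey, c.evalC_prodCS v val hkey, Finset.sum_sub_distrib]
  push_cast; ring

/-- **Square contributions:** `evalC (sqCS s) = −n·Σ_g u(v_g)²`. -/
theorem evalC_sqCS (s : SqE) :
    evalC val (c.sqCS s) = -((s.n : ℝ) * ∑ g, linv c.NV s.u (v g) * linv c.NV s.u (v g)) := by
  unfold sqCS
  rw [evalC_flatten, List.map_map]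
  set U := suppOf c.NV (tb (s.m1 ||| s.m2)) with hU
  have hc : U.map (evalC val ∘ fun i => U.map fun j => (c.key i j, -((s.n : ℤ) * s.u i * s.u j))) =
      U.map fun i => (U.map fun j => (s.u i : ℝ) * (-(s.n : ℝ) * (s.u j : ℝ)) * Msym v i j).sum :=
    List.map_congr_left fun i hi => by
      rw [Function.comp_apply, evalC_map]
      congr 1
      refine List.map_congr_left fun j hj => ?_
      simp only []
      rw [hkey i (mem_suppOf hi).1 j (mem_suppOf hj).1]; push_cast; ring
  rw [hc, grid_Msym v (fun i => (s.u i : ℝ)) (fun j => -(s.n : ℝ) * (s.u j : ℝ)), Finset.mul_sum, ← Finset.sum_neg_distrib]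
  refine Finset.sum_congr rfl fun g _ => ?_
  rw [linv_u_eq_suppOf]
  have h2 : (U.map fun j => -(s.n : ℝ) * (s.u j : ℝ) * v g j) = U.map fun j => -(s.n : ℝ) * ((s.u j : ℝ) * v g j) :=
    List.map_congr_left fun j _ => by ring
  rw [h2, List.sum_map_mul_left]
  ring

/-- **Multiplier contributions:** `evalC (ellC (b, n)) = n·Σ_g Λ(v_g)·v_g(b)` with `Λ(v) = cN·v_D − cD·T(v)`. -/
theorem evalC_ellC (e : ℕ × ℕ) (hb : e.1 < c.NV) :
    evalC val (c.ellC e) = (e.2 : ℝ) * ∑ g, c.base.Λ (v g) * v g e.1 := by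
  unfold ellC Cert.Λ
  rw [evalC, List.map_cons, List.sum_cons, ← evalC, evalC_map, hkey _ c.base.D_lt_NV _ hb, Msym]
  have hc : ((suppOf c.NV c.base.tMem).map fun i => (((c.key i e.1, -((e.2 : ℤ) * c.base.cD)) : ℕ × ℤ).2 : ℝ) *
      val ((c.key i e.1, -((e.2 : ℤ) * c.base.cD)) : ℕ × ℤ).1) =
      (suppOf c.NV c.base.tMem).map fun i => (-((e.2 : ℝ) * c.base.cD)) * Msym v i e.1 :=
    List.map_congr_left fun i hi => by simp only []; rw [hkey i (mem_suppOf hi).1 _ hb]; push_cast; ring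
  rw [hc, col_Msym v e.1, Finset.mul_sum, Finset.mul_sum, ← Finset.sum_add_distrib]
  refine Finset.sum_congr rfl fun g _ => ?_
  rw [List.sum_map_mul_left, linv_bi_eq_suppOf]
  push_cast; ring

/-- **Marginal-slack contributions:** `evalC (linC1 (x, b, n)) = −n·Σ_g (v_g(D) − m_x(v_g))·v_g(b)`. -/
theorem evalC_linC1 (e : ℕ × ℕ × ℕ) (hb : e.2.1 < c.NV) :
    evalC val (c.linC1 e) =
      -((e.2.2 : ℝ) * ∑ g, (v g c.base.D - linv c.NV (fun i => Cert.bi (c.base.margMem e.1 i)) (v g)) * v g e.2.1) := by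
  unfold linC1
  rw [evalC, List.map_cons, List.sum_cons, ← evalC, evalC_map, hkey _ c.base.D_lt_NV _ hb, Msym]
  have hc : ((suppOf c.NV (c.base.margMem e.1)).map fun i => (((c.key i e.2.1, (e.2.2 : ℤ)) : ℕ × ℤ).2 : ℝ) *
      val ((c.key i e.2.1, (e.2.2 : ℤ)) : ℕ × ℤ).1) =
      (suppOf c.NV (c.base.margMem e.1)).map fun i => (e.2.2 : ℝ) * Msym v i e.2.1 :=
    List.map_congr_left fun i hi => by simp only []; rw [hkey i (mem_suppOf hi).1 _ hb]; push_cast; ring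
  rw [hc, col_Msym v e.2.1, Finset.mul_sum, Finset.mul_sum, ← Finset.sum_neg_distrib, ← Finset.sum_add_distrib]
  refine Finset.sum_congr rfl fun g _ => ?_
  rw [List.sum_map_mul_left, linv_bi_eq_suppOf]
  push_cast; ring

end Eval

/-! ### Soundness -/

/-- Facts extracted from `checkWS`. -/
theorem checkWS_spec (h : c.checkWS = true) :
    0 < c.base.cD ∧ 1 ≤ c.base.h ∧ 0 < c.ellDS ∧ (∀ e ∈ c.ell, e.1 < c.NV) ∧ (∀ e ∈ c.lin, e.1 < c.base.m ∧ e.2.1 < c.NV) ∧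
    (∀ ch ∈ c.rows, ∀ r ∈ ch, c.base.rowOK r = true) := by
  unfold checkWS at h
  simp only [Bool.and_eq_true] at h
  obtain ⟨⟨⟨⟨⟨h1, h2⟩, h3⟩, h4⟩, h5⟩, h6⟩ := h
  rw [List.all_eq_true] at h4 h5 h6
  refine ⟨of_decide_eq_true h1, of_decide_eq_true h2, of_decide_eq_true h3, fun e he => of_decide_eq_true (h4 e he), fun e he => ?_,
    fun ch hch r hr => ?_⟩
  · have h := h5 e he
    simp only [Bool.and_eq_true, decide_eq_true_eq] at h
    exact h
  · have h := h6 ch hch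
    rw [List.all_eq_true] at h
    exact h r hr

/-- `ℓ_D·Σ_g v_g(D) ≤ Σ_{(b,n)} n·Σ_g v_g(b)` at nonnegative points. -/
theorem ellDS_mul_le (v : G → ℕ → ℝ) (hv : ∀ g i, 0 ≤ v g i) :
    (c.ellDS : ℝ) * ∑ g, v g c.base.D ≤ (c.ell.map fun e => (e.2 : ℝ) * ∑ g, v g e.1).sum := by
  unfold ellDS
  rw [natCast_listSum, ← listSum_mul_const]
  refine listSum_mono _ _ _ fun e _ => ?_
  split_ifs with h
  · rw [h]
  · rw [Nat.cast_zero, zero_mul]; exact mul_nonneg (Nat.cast_nonneg _) (Finset.sum_nonneg fun g _ => hv g _)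

/-- **SOUNDNESS, evaluation form.**  For a finite nonempty family of nonnegative points with common `v_g(D) = δ` and common `T(v_g) = μ_T`,
satisfying the marginal hypotheses and the listed rows, and a key valuation with the orbit property `val (keyS m i j) = Σ_g v_g(i)·v_g(j)` at which
the contribution list evaluates nonnegatively, a structurally sound certificate gives `cD·μ_T ≤ cN·δ`. -/
theorem soundS_of_nonneg [Nonempty G] (hW : c.checkWS = true) (v : G → ℕ → ℝ) (hv : ∀ g i, 0 ≤ v g i)
    (val : ℕ → ℝ) (hpos : 0 ≤ evalC val c.contribsS) (hkey : ∀ i < c.NV, ∀ j < c.NV, val (c.key i j) = Msym v i j)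
    (δ μT : ℝ) (hD : ∀ g, v g c.base.D = δ) (hT : ∀ g, linv c.NV (fun i => Cert.bi (c.base.tMem i)) (v g) = μT)
    (hmarg : ∀ g, ∀ x < c.base.m, linv c.NV (fun i => Cert.bi (c.base.margMem x i)) (v g) ≤ v g c.base.D)
    (hrows : ∀ g, ∀ ch ∈ c.rows, ∀ r ∈ ch,
      linv c.NV (fun i => Cert.bi (tb r.m1 i)) (v g) * linv c.NV (fun i => Cert.bi (tb r.m2 i)) (v g) ≤
        linv c.NV (fun i => Cert.bi (tb r.m3 i)) (v g) * linv c.NV (fun i => Cert.bi (tb r.m4 i)) (v g)) :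
    (c.base.cD : ℝ) * μT ≤ c.base.cN * δ := by
  obtain ⟨_, hh, hDD, hell, hlin, _⟩ := c.checkWS_spec hW
  have hsplit : evalC val c.contribsS =
      ((c.ell.map c.ellC).map (evalC val)).sum + ((c.lin.map c.linC1).map (evalC val)).sum +
      ((c.rows.map fun ch => (ch.map c.rowCS).flatten).map (evalC val)).sum +
      ((c.sqs.map fun ch => (ch.map c.sqCS).flatten).map (evalC val)).sum := by
    unfold contribsS; rw [evalC_append, evalC_append, evalC_append, evalC_flatten, evalC_flatten, evalC_flatten, evalC_flatten]
  have hΛ : ∀ g, c.base.Λ (v g) = c.base.cN * δ - c.base.cD * μT := fun g => by unfold Cert.Λ; rw [hD g, hT g]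
  have h1 : ((c.ell.map c.ellC).map (evalC val)).sum =
      (c.base.cN * δ - c.base.cD * μT) * (c.ell.map fun e => (e.2 : ℝ) * ∑ g, v g e.1).sum := by
    rw [List.map_map, ← List.sum_map_mul_left]
    congr 1
    refine List.map_congr_left fun e he => ?_
    rw [Function.comp_apply, c.evalC_ellC v val hkey e (hell e he), Finset.mul_sum, Finset.mul_sum, Finset.mul_sum]
    refine Finset.sum_congr rfl fun g _ => ?_
    rw [hΛ g]; ring
  have h2 : ((c.lin.map c.linC1).map (evalC val)).sum ≤ 0 := by
    rw [List.map_map]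
    refine listSum_nonpos _ _ fun e he => ?_
    obtain ⟨hx, hb⟩ := hlin e he
    rw [Function.comp_apply, c.evalC_linC1 v val hkey e hb, neg_nonpos]
    exact mul_nonneg (Nat.cast_nonneg _) (Finset.sum_nonneg fun g _ => mul_nonneg (sub_nonneg.2 (hmarg g e.1 hx)) (hv g _))
  have h3 : ((c.rows.map fun ch => (ch.map c.rowCS).flatten).map (evalC val)).sum ≤ 0 := by
    rw [List.map_map]
    refine listSum_nonpos _ _ fun ch hch => ?_
    rw [Function.comp_apply, evalC_flatten, List.map_map]
    refine listSum_nonpos _ _ fun r hr => ?_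
    rw [Function.comp_apply, c.evalC_rowCS v val hkey r, neg_nonpos]
    exact mul_nonneg (Nat.cast_nonneg _) (Finset.sum_nonneg fun g _ => sub_nonneg.2 (hrows g ch hch r hr))
  have h4 : ((c.sqs.map fun ch => (ch.map c.sqCS).flatten).map (evalC val)).sum ≤ 0 := by
    rw [List.map_map]
    refine listSum_nonpos _ _ fun ch _ => ?_
    rw [Function.comp_apply, evalC_flatten, List.map_map]
    refine listSum_nonpos _ _ fun s _ => ?_
    rw [Function.comp_apply, c.evalC_sqCS v val hkey s, neg_nonpos]
    exact mul_nonneg (Nat.cast_nonneg _) (Finset.sum_nonneg fun g _ => mul_self_nonneg _)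
  have hmain : 0 ≤ (c.base.cN * δ - c.base.cD * μT) * (c.ell.map fun e => (e.2 : ℝ) * ∑ g, v g e.1).sum := by
    rw [hsplit, h1] at hpos; linarith
  have hellle := c.ellDS_mul_le v hv
  have hsumD : ∑ g : G, v g c.base.D = Fintype.card G * δ := by
    rw [Finset.sum_congr rfl fun g _ => hD g, Finset.sum_const, Finset.card_univ, nsmul_eq_mul]
  obtain ⟨g₀⟩ := (inferInstance : Nonempty G)
  have hδ0 : 0 ≤ δ := by rw [← hD g₀]; exact hv g₀ _
  rcases eq_or_lt_of_le hδ0 with hδ | hδ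
  · -- `δ = 0`: the marginals force `T(v_g) = 0`
    have h0 := c.base.tForm_eq_zero hh (v g₀) (hv g₀) (hmarg g₀) (by rw [hD g₀, ← hδ])
    rw [hT g₀] at h0
    rw [h0, ← hδ, mul_zero, mul_zero]
  · have hcard : (0 : ℝ) < Fintype.card G := by exact_mod_cast Fintype.card_pos
    have hellpos : 0 < (c.ell.map fun e => (e.2 : ℝ) * ∑ g, v g e.1).sum := lt_of_lt_of_le (by rw [hsumD]; exact mul_pos (by exact_mod_cast hDD) (mul_pos hcard hδ)) hellle
    have hΛ0 : 0 ≤ c.base.cN * δ - c.base.cD * μT := by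
      by_contra hneg
      push Not at hneg
      have := mul_neg_of_neg_of_pos hneg hellpos
      linarith
    linarith

/-- **SOUNDNESS OF THE SYMMETRISED CERTIFICATES (abstract).**  As `soundS_of_nonneg`, with the nonnegativity supplied by the key check `checkQS`
at a nonnegative valuation. -/
theorem soundS [Nonempty G] (fuel : ℕ) (hW : c.checkWS = true) (hQ : c.checkQS fuel = true) (v : G → ℕ → ℝ) (hv : ∀ g i, 0 ≤ v g i)
    (val : ℕ → ℝ) (hval : ∀ k, 0 ≤ val k) (hkey : ∀ i < c.NV, ∀ j < c.NV, val (c.key i j) = Msym v i j)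
    (δ μT : ℝ) (hD : ∀ g, v g c.base.D = δ) (hT : ∀ g, linv c.NV (fun i => Cert.bi (c.base.tMem i)) (v g) = μT)
    (hmarg : ∀ g, ∀ x < c.base.m, linv c.NV (fun i => Cert.bi (c.base.margMem x i)) (v g) ≤ v g c.base.D)
    (hrows : ∀ g, ∀ ch ∈ c.rows, ∀ r ∈ ch,
      linv c.NV (fun i => Cert.bi (tb r.m1 i)) (v g) * linv c.NV (fun i => Cert.bi (tb r.m2 i)) (v g) ≤
        linv c.NV (fun i => Cert.bi (tb r.m3 i)) (v g) * linv c.NV (fun i => Cert.bi (tb r.m4 i)) (v g)) :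
    (c.base.cD : ℝ) * μT ≤ c.base.cN * δ :=
  c.soundS_of_nonneg hW v hv val (evalC_nonneg_of_runsOK_msort2 _ hval fuel _ hQ) hkey δ μT hD hT hmarg hrows

end SymCert

end

end QCert
end HubOnly

end Summit.CriticalPhenomena.PercolationContinuityZ3.Theorems
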